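import Mathlib
import Literature.AlgebraicGeometry.Resolution.TranscendenceDefect
import Literature.AlgebraicGeometry.Resolution.AbhyankarMonomialUniformization
import Summits.ResolutionOfSingularities.ResolutionOfSingularities.Theorems.RadicialJungCleanModelsLocalMonomializationGroundFieldDescent
import Summits.ResolutionOfSingularities.ResolutionOfSingularities.Theorems.RadicialJungCleanModelsAbhyankarGroundFieldTower
import HarnessLib

/-!
# Route `RadicialJung`, crux `CleanModels` (stmt-15917), line `Sketch` rev 35, stub 7 `stub_cleanModelsDimGEFour`: local monomialization at EVERY
# Abhyankar place over a ground field finitely generated over a PERFECT field, modulo Knaf–Kuhlmann 2005 Thm. 1.1 (general form)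

Explicit-unit seat `decomp-res-hand-2` g3 (structural hand, stubs 5–7).  OURS; nothing here proves resolution in characteristic `p`.

Assembly of ✓ `localMonomialization_at_abhyankarPlace_of_subfield` (`…LocalMonomializationGroundFieldDescent.lean`: the ground-field descent, hypotheses
over the subfield `k₀`) with ✓ `transcendenceDefect_eq_zero_of_tower` and ✓ `exists_sepGen_residueField_of_perfect_subfield`
(`…AbhyankarGroundFieldTower.lean`: those hypotheses from the `k`-data when `k₀` is perfect):

* `localMonomialization_at_abhyankarPlace_of_perfectSubfield` — for fields `k₀ → k → K` with `k₀` PERFECT and `k = k₀(T)` finitely generated over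
  `k₀`, a finitely generated `k`-model `A ⊆ O` of `K` and a valuation ring `O` ABHYANKAR over `k` (transcendence defect `0`; NO hypothesis on the
  residue field — it may be inseparable over `k`), every finite `Z ⊆ A` is monomialized along `O` on a finitely generated `A ⊆ A' ⊆ O` regular at
  the centre: the hypothesis `hMono` of ✓ `cleanModels_dim_of_localMonomialization` at `O`, GRANTED the printed fact
  `Literature.AlgebraicGeometry.Resolution.KnafKuhlmann2005_Thm11_monomialFormSepGen`.

Census consequence for stub 7: over every ground field finitely generated over a perfect field (all finite fields, `𝔽_p(t₁,…,t_m)`, number-function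
fields…), the Abhyankar column of the local-uniformization input `hMono_d` is PRINT (Knaf–Kuhlmann 2005 Thm. 1.1, general form), inseparable residue
fields included; what remains of `hMono_d` there is local uniformization with monomialization at NON-Abhyankar zero-dimensional valuations (open for
`d ≥ 4`).  Structural bookkeeping, counted 0.
-/

noncomputable section

set_option linter.dupNamespace false -- mandated namespace of this single-conjunct summit

open IsLocalRing
open Literature.AlgebraicGeometry.Resolution

namespace Summit.ResolutionOfSingularities.ResolutionOfSingularities.Theorems.RadicialJung.CleanModels

/-- **Local monomialization at an Abhyankar place over a ground field finitely generated over a perfect field, from Knaf–Kuhlmann 2005 Thm. 1.1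
(general form).**  Fields `k₀ → k → K`, `k₀` perfect, `k = k₀(T)`; `O` a valuation ring of `K`; `A ⊆ O` a finitely generated `k`-subalgebra with
`Frac A = K`; `O ⊇ k` of transcendence defect `0` over `k`; `Z ⊆ A` finite.  Then, granted `KnafKuhlmann2005_Thm11_monomialFormSepGen`, there is a
finitely generated `A ⊆ A' ⊆ O` whose local ring at the centre of `O` is regular, with a regular system of parameters in which every non-zero
`z ∈ Z` is an `𝒪`-monomial.  Proof: `O` is Abhyankar over `k₀` (✓ `transcendenceDefect_eq_zero_of_tower`) with `κ(O)/k₀` separably generated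
(✓ `exists_sepGen_residueField_of_perfect_subfield`, Cor. 2.2 + perfectness), so ✓ `localMonomialization_at_abhyankarPlace_of_subfield` applies.
[cite: KnafKuhlmann2005, Thm. 1.1 and Cor. 2.2] -/
theorem localMonomialization_at_abhyankarPlace_of_perfectSubfield
    (hKKg : Literature.AlgebraicGeometry.Resolution.KnafKuhlmann2005_Thm11_monomialFormSepGen.{0, 0})
    (k₀ k K : Type) [Field k₀] [PerfectField k₀] [Field k] [Field K] [Algebra k₀ k] [Algebra k K] [Algebra k₀ K]
    [IsScalarTower k₀ k K]
    (T : Finset k) (hT : IntermediateField.adjoin k₀ (T : Set k) = ⊤)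
    (O : ValuationSubring K) (A : Subalgebra k K) (hAO : A.toSubring ≤ O.toSubring) (hAfg : A.FG)
    (hfrac : IsFractionRing A K)
    (hk : ∀ c : k, algebraMap k K c ∈ O) (htd : transcendenceDefect k O hk = 0)
    (Z : Finset K) (hZ : ∀ z ∈ Z, z ∈ A) :
    ∃ (A' : Subalgebra k K), A'.toSubring ≤ O.toSubring ∧ A ≤ A' ∧ A'.FG ∧
    ∃ (_ : IsRegularLocalRing (locAtCentre A'.toSubring O)) (e : ℕ) (a : Fin e → ↥(locAtCentre A'.toSubring O)),
      Ideal.span (Set.range a) = IsLocalRing.maximalIdeal ↥(locAtCentre A'.toSubring O) ∧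
      ringKrullDim ↥(locAtCentre A'.toSubring O) = (e : WithBot ℕ∞) ∧
      ∀ z ∈ Z, z ≠ 0 → ∃ (v : ↥(locAtCentre A'.toSubring O)) (μ : Fin e → ℕ), IsUnit v ∧
        z = (v : K) * ∏ i, ((a i : ↥(locAtCentre A'.toSubring O)) : K) ^ (μ i) := by
  have hk₀ : ∀ c : k₀, algebraMap k₀ K c ∈ O := fun c => by
    rw [IsScalarTower.algebraMap_apply k₀ k K]
    exact hk _
  have hKfg : (⊤ : IntermediateField k K).FG := intermediateField_top_fg A hAfg hfrac
  have htd₀ : transcendenceDefect k₀ O hk₀ = 0 :=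
    transcendenceDefect_eq_zero_of_tower k₀ k K ⟨T, hT⟩ hKfg O hk hk₀ htd
  have hsep₀ := exists_sepGen_residueField_of_perfect_subfield k₀ k K T hT hKfg O hk hk₀ htd
  exact localMonomialization_at_abhyankarPlace_of_subfield hKKg k₀ k K T hT O A hAO hAfg hfrac hk₀ htd₀ hsep₀ Z hZ

end Summit.ResolutionOfSingularities.ResolutionOfSingularities.Theorems.RadicialJung.CleanModels

end
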